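import Mathlib
import HarnessLib
import Summits.Langlands.Langlands.Theses.SplitPrimeInduction
import Summits.Langlands.Langlands.Theses.TwistAveragedDeinduction
import Summits.Langlands.Langlands.Theorems.IrreducibilityBySelfDualityReciprocityUpToIrreducibilityCorrespondsConj

/-!
# Birth skeleton (BC3) for crux stmt-Langlands-16011
`Summit.Langlands.Langlands.Theses.SplitPrimeInduction.LanglandsOverQ` — line `birth`

Route `route-Langlands-SplitPrimeInduction` (rev 11; deciding theorem
`closes (h₁ : LanglandsOverQ) (h₂ : TorsionLeviInduction) (h₃ : MonomialSerreAtSplitPrimes)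
(h₄ : DeinductionR) (hA : Assembly) : Langlands := hA h₂ h₃ h₁ h₄`).  The crux (rank 4, shared
verbatim with `TwistAveragedDeinduction.LanglandsOverQ`, same ledger item) is the summit body over the
ONE field `ℚ`:

  `LanglandsOverQ := ∃ Rec : ReciprocityData ℚ, ∀ n > 0, ∀ hcpt, GlobalLanglandsCorrespondenceGLn n ℚ Rec hcpt`

(both directions, all ranks `n`, ALL weights, local–global compatibility at every prime).  It is
trivially implied by the summit (`Langlands → LanglandsOverQ`: instantiate `∀ F` at `ℚ` and take `Rec` from
the non-vacuity conjunct — a two-line term, checked in the planner's probe file `bc/probe_S_to_C.lean`, not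
restated here so that no declaration of this file concludes the crux from the summit) and is an OPEN PROBLEM
whose hard core is archimedean: the Hodge-irregular sector over `ℚ` (Maass forms of eigenvalue `1/4`, even Artin
representations, irregular `ρ`), on which `Literature.Barriers.Langlands.NonRegularWeightBarrier` bites and
which no route of the tree evades (route header, crux docstring "why it might fail").

## The skeleton: three named stubs cut along the two seams every known engine respects

* the DIRECTION seam — (A) construction of Galois representations / (B) automorphy of geometric Galois
  representations (as in the registered exemplar `Cruxes/ReciprocityTRCM/Lines/birth.lean`), and
* on the (A) side, the WEIGHT seam — REGULAR versus IRREGULAR L-algebraic `π` (typed with the accepted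
  `InfinityType.IsRegular` / `InfinityType.IsLAlgebraic` / `AutomorphicRepData.HasInfinityType`), which is
  exactly the line along which `NonRegularWeightBarrier` separates what cohomology sees from what it does not.

1. `stub_autToGalRegularQ` — (A)-EXISTENCE over `ℚ` for REGULAR L-algebraic cuspidal `π` (= twists by
   `|det|^{(n-1)/2}` of Clozel-regular-algebraic = cohomological `π`), for ONE reciprocity datum `R`: an
   irreducible geometric `ρ_{π,ι}` corresponding to `π` at EVERY prime.  Existence of a Satake-compatible
   avatar is KNOWN (`ℚ` is totally real: Harris–Lan–Taylor–Thorne 2016 Thm. A, Scholze 2015 Thm. 1.0.4 /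
   V.4.2; de Rham: A'Campo 2024), local–global compatibility at `v ∤ ℓ` up to the monodromy operator is
   Varma's theorem; OPEN sub-clauses: irreducibility of `ρ_{π,ι}` for general `n`, the monodromy operator
   at `v ∤ ℓ` and the full `WD(D_pst)` clause at `v = ℓ` outside the polarisable case.  Size XL.
2. `stub_autToGalIrregularQ` — (A)-EXISTENCE over `ℚ` for IRREGULAR L-algebraic cuspidal `π`, GIVEN the
   regular case for the same `R` (every engine for irregular weight — Deligne–Serre, Taylor 1991,
   Goldring–Koskivirta, Pilloni–Stroh, Boxer–Calegari–Gee–Pilloni — consumes the Galois representations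
   of REGULAR forms through congruences / `p`-adic limits): THE ARCHIMEDEAN CORE (Maass `λ = 1/4` already
   for `n = 2`: no realisation in any cohomology, no congruence engine).  OPEN PROBLEM; false as typed iff
   Buzzard–Gee Conj. 3.1.5 fails over `ℚ` (an L-algebraic `π` with a transcendental Satake parameter).
3. `stub_weakGalToAutQ` — WEAK (B) over `ℚ` GIVEN (A) for the same `R`: every irreducible geometric
   `ρ : Γ_ℚ → GL_n(ℚ̄_ℓ)` (pinned Fontaine datum) is Satake–Frobenius compatible almost everywhere with
   some L-algebraic cuspidal `π` of `GL_n(𝔸_ℚ)` — Fontaine–Mazur–Langlands over `ℚ` in its a.e. form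
   (known: `n = 1` class field theory, `n = 2` odd via Serre's conjecture + Kisin/Emerton/Pan; OPEN: even
   `n = 2`, every `n ≥ 3` beyond potential automorphy).  Local–global compatibility is NOT asked: it is
   recovered in the seam from (A).

The composition `LanglandsOverQ_of` is kernel-checked and sorry-free and is NOT a one-line seam: it
(i) rebuilds (A) for `R` by a case split on regularity of the infinity type, (ii) PROVES the uniqueness
clause of (A) (conjugacy of any two correspondents, one irreducible) by the landed Chebotarev–Brauer–Nesbitt
transport `Theorems.ReciprocityUpToIrreducibility.isConjugate_of_satakeFrobCompatibleAt`, and (iii) UPGRADES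
weak (B) to the summit's (B) (local–global compatibility at every prime) by the landed
`Theorems.ReciprocityUpToIrreducibility.corresponds_of_exists_corresponds` (two irreducible avatars of one
`π` are conjugate and `Corresponds` descends to conjugacy classes) — lemma `galoisToAutomorphic_of_weak`
below, sorry-free.  The shared sibling decl `TwistAveragedDeinduction.LanglandsOverQ` follows verbatim
(`langlandsOverQ_twistAveraged_of`, definitional).

Shape (for `ledger skeleton check` / `#h21_check_skeleton`): each stub is `theorem stub_<name> : <Prop> :=
by sorry` (closed statements over existing declarations only); `_Goal.stub_<name> : Prop := type_of%
@stub_<name>` names that statement; `LanglandsOverQ_of (h₁ : _Goal.stub_autToGalRegularQ)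
(h₂ : _Goal.stub_autToGalIrregularQ) (h₃ : _Goal.stub_weakGalToAutQ) : LanglandsOverQ` concludes the route
decl BY NAME; the last `example` feeds the three stubs to it.  Sorries: exactly the three stubs.

Disproof used: none exists — `ledger crux ls stmt-Langlands-16011` lists no workfiles (no `Disproof.lean`,
no `Negative/` lemma, no dead line) at registration time (2026-08-17); `ledger negatives --problem Langlands`
holds nothing of the shape of these stubs (the route's own settled negative, `SplitPrimeInductionDeinduction_refuted`,
concerns Galois de-induction, not reciprocity over `ℚ`).  `IsGeometricFramed R ρ` reads the PINNED Fontaine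
datum (`ReciprocityData.pst` ignores `R`, D-0018 L2), so the `∀ R` of stubs 2–3 cannot be met by a permissive
prover-chosen period ring (the LiftDescend `PotentialAutomorphy` misstatement cannot recur).

References: K. Buzzard, T. Gee, LMS LNS 414 (2014), Conj. 3.1.5, 3.2.1–3.2.2 [BuzzardGeeLMS2014];
J.-M. Fontaine, B. Mazur (1995), Conj. 1 [FontaineMazurGeometric1995]; M. Harris, K.-W. Lan, R. Taylor,
J. Thorne, Res. Math. Sci. 3 (2016), Thm. A [HarrisLanTaylorThorneRMS2016]; P. Scholze, Ann. of Math. 182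
(2015), Thm. 1.0.4 [Scholze2015]; F. Calegari, ICM 2022 survey [Calegari2023]; P. Deligne, J.-P. Serre,
ASENS 7 (1974), Lemme 3.2 and Thm. 4.1 [DeligneSerreASENS1974]; L. Clozel, Ann Arbor (1990), Déf. 1.8, 3.12,
Conj. 4.5 [Clozel1990].
-/

set_option linter.dupNamespace false

noncomputable section

namespace Summit.Langlands.Langlands.Cruxes.LanglandsOverQ.Birth

open Summit.Langlands.Langlands.Theses.SplitPrimeInduction (LanglandsOverQ)
open Filter
open Literature.NumberTheory.Automorphic Literature.NumberTheory.GaloisRepresentations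

/-! ## 1. The three stubs (the ONLY sorries of this file) -/

/-- **STUB 1 — direction (A), existence, over `ℚ`, REGULAR L-algebraic weights, all ranks, all primes.**
There are reciprocity data `R` over `ℚ` such that every cuspidal `π` of `GL_n(𝔸_ℚ)`, `n ≥ 1`, having an
L-algebraic AND regular infinity type (integral exponents, pairwise distinct at the one embedding — the
twists by `|det|^{(n-1)/2}` of Clozel's regular algebraic = cohomological representations) has, for
all `ℓ`, `ι`, an IRREDUCIBLE geometric `ρ : Γ_ℚ → GL_n(ℚ̄_ℓ)` corresponding to it (Satake–Frobenius
a.e. AND local–global compatibility at every prime, `Corresponds R ι π ρ`).  Known: the avatar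
(Harris–Lan–Taylor–Thorne / Scholze, `ℚ` totally real), de Rham at `ℓ` (A'Campo), compatibility at
`p ≠ ℓ` up to monodromy (Varma).  Open as typed: irreducibility for general `n`; the monodromy operator
and the `D_pst` clause outside the polarisable (Shin, Caraiani) case.  Why it might fail: only through
those open sub-clauses — no candidate counterexample is known.
[cite: HarrisLanTaylorThorneRMS2016, Thm. A] [cite: Scholze2015, Thm. 1.0.4] [cite: BuzzardGeeLMS2014, Conj. 3.2.2] -/
theorem stub_autToGalRegularQ : ∃ R : ReciprocityData ℚ, ∀ n : ℕ, 0 < n → ∀ (hcpt : Literature.NumberTheory.Automorphic.isCompact_glFiniteIntegralLevel n ℚ) (π : Literature.NumberTheory.Automorphic.CuspidalAutomorphicRepData n ℚ hcpt), (∃ T : Literature.NumberTheory.Automorphic.InfinityType ℚ n, π.1.HasInfinityType T ∧ T.IsLAlgebraic ∧ T.IsRegular) → ∀ (ℓ : ℕ) [Fact ℓ.Prime] (ι : PadicAlgCl ℓ ≃+* ℂ), ∃ ρ : Literature.NumberTheory.GaloisRepresentations.FramedGaloisRep ℚ (PadicAlgCl ℓ) n, ρ.toGaloisRep.IsIrreducible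 ∧ IsGeometricFramed R ρ ∧ Corresponds R ι π.1 ρ := by
  sorry

/-- **STUB 2 — direction (A), existence, over `ℚ`, IRREGULAR L-algebraic weights, given the regular case
for the same data: THE ARCHIMEDEAN CORE.**  For every reciprocity datum `R` over `ℚ` carrying stub 1's
conclusion (irreducible geometric correspondents for all regular L-algebraic cuspidal `π`, all ranks),
every L-algebraic cuspidal `π` of `GL_n(𝔸_ℚ)` with NO regular L-algebraic infinity type (Maass forms of
eigenvalue `1/4` and their functorial images, weight-one-type representations, …) also has, for all
`ℓ`, `ι`, an irreducible geometric `ρ` corresponding to it at every prime.  Every known engine in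
irregular weight (Deligne–Serre; `p`-adic limits of regular forms: Taylor, Goldring–Koskivirta,
Pilloni–Stroh, Boxer–Calegari–Gee–Pilloni) consumes the hypothesis and needs a realisation in COHERENT
cohomology of a Shimura variety, which Maass forms lack: OPEN PROBLEM (`NonRegularWeightBarrier`).  Why it
might fail: false as typed iff Buzzard–Gee Conj. 3.1.5 fails over `ℚ` (an L-algebraic `π` with a
transcendental Satake parameter has no `ρ_{π,ι}` for generic `ι`).
[cite: BuzzardGeeLMS2014, Conj. 3.1.5 and Conj. 3.2.2] [cite: DeligneSerreASENS1974, Thm. 4.1] [cite: Calegari2023, §2] -/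
theorem stub_autToGalIrregularQ : ∀ R : ReciprocityData ℚ, (∀ n : ℕ, 0 < n → ∀ (hcpt : Literature.NumberTheory.Automorphic.isCompact_glFiniteIntegralLevel n ℚ) (π : Literature.NumberTheory.Automorphic.CuspidalAutomorphicRepData n ℚ hcpt), (∃ T : Literature.NumberTheory.Automorphic.InfinityType ℚ n, π.1.HasInfinityType T ∧ T.IsLAlgebraic ∧ T.IsRegular) → ∀ (ℓ : ℕ) [Fact ℓ.Prime] (ι : PadicAlgCl ℓ ≃+* ℂ), ∃ ρ : Literature.NumberTheory.GaloisRepresentations.FramedGaloisRep ℚ (PadicAlgCl ℓ) n, ρ.toGaloisRep.IsIrreducible ∧ IsGeometricFramed R ρ ∧ Corresponds R ι π.1 ρ) → ∀ n : ℕ, 0 < n → ∀ (hcpt : Literature.NumberTheory.Automorphic.isCompact_glFiniteIntegralLevel n ℚ) (π : Literature.NumberTheory.Automorphic.CuspidalAutomorphicRepData n ℚ hcpt), π.1.IsLAlgebraic → ¬ (∃ T : Literature.NumberTheory.Automorphic.InfinityType ℚ n, π.1.HasInfinityType T ∧ T.IsLAlgebraic ∧ T.IsRegular) → ∀ (ℓ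 : ℕ) [Fact ℓ.Prime] (ι : PadicAlgCl ℓ ≃+* ℂ), ∃ ρ : Literature.NumberTheory.GaloisRepresentations.FramedGaloisRep ℚ (PadicAlgCl ℓ) n, ρ.toGaloisRep.IsIrreducible ∧ IsGeometricFramed R ρ ∧ Corresponds R ι π.1 ρ := by
  sorry

/-- **STUB 3 — weak direction (B) over `ℚ`, given (A) for the same data** (Fontaine–Mazur–Langlands over
`ℚ`, almost-everywhere form): for reciprocity data `R` over `ℚ` carrying direction (A) in every rank,
every irreducible `ρ : Γ_ℚ → GL_n(ℚ̄_ℓ)` which is geometric (unramified a.e., de Rham at `ℓ` for the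
PINNED Fontaine datum — `IsGeometricFramed R ρ` does not depend on `R`) is Satake–Frobenius compatible at
almost all primes with some L-algebraic cuspidal `π` of `GL_n(𝔸_ℚ)`.  The hypothesis (A) is what every
automorphy-lifting theorem consumes (the `ρ_π` to compare with).  Known: `n = 1` (class field theory),
odd `n = 2` (Serre's conjecture, Kisin, Emerton, Pan); OPEN: even two-dimensional `ρ` (even Artin, the
`λ = 1/4` side), every `n ≥ 3` (potential automorphy is only potential).  Local–global compatibility at
the primes is NOT asked here: it is recovered in `galoisToAutomorphic_of_weak` from (A).  Why it might
fail: it is Fontaine–Mazur Conj. 1 + Langlands over `ℚ`; false only if that is.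
[cite: FontaineMazurGeometric1995, Conj. 1] [cite: BuzzardGeeLMS2014, Conj. 3.2.2] [cite: Calegari2023, §2] -/
theorem stub_weakGalToAutQ : ∀ R : ReciprocityData ℚ, (∀ n : ℕ, 0 < n → ∀ hcpt : Literature.NumberTheory.Automorphic.isCompact_glFiniteIntegralLevel n ℚ, AutomorphicToGalois n R hcpt) → ∀ (n : ℕ), 0 < n → ∀ (ℓ : ℕ) [Fact ℓ.Prime] (ι : PadicAlgCl ℓ ≃+* ℂ) (ρ : Literature.NumberTheory.GaloisRepresentations.FramedGaloisRep ℚ (PadicAlgCl ℓ) n), ρ.toGaloisRep.IsIrreducible → IsGeometricFramed R ρ → ∀ hcpt : Literature.NumberTheory.Automorphic.isCompact_glFiniteIntegralLevel n ℚ, ∃ π : Literature.NumberTheory.Automorphic.CuspidalAutomorphicRepData n ℚ hcpt, π.1.IsLAlgebraic ∧ ∀ᶠ v : IsDedekindDomain.HeightOneSpectrum (NumberField.RingOfIntegers ℚ) in cofinite, SatakeFrobCompatibleAt ι π.1 ρ v := by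
  sorry

/-! ## 2. The stub statements as named propositions (the composition's hypotheses, by name)

`_Goal` is internal on purpose: audits listing the file's declarations by short name find the `stub_*`
THEOREMS, while `#h21_check_skeleton` accepts the hypotheses of `LanglandsOverQ_of` by the stub names they
carry.  Each `_Goal.stub_x` is `type_of% @stub_x` — no text duplicated, no `sorry` inherited. -/

namespace _Goal

/-- The statement of `stub_autToGalRegularQ`, as a named `Prop` (literally its type). [folklore] -/
def stub_autToGalRegularQ : Prop :=
  type_of% @Summit.Langlands.Langlands.Cruxes.LanglandsOverQ.Birth.stub_autToGalRegularQ

/-- The statement of `stub_autToGalIrregularQ`, as a named `Prop` (literally its type). [folklore] -/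
def stub_autToGalIrregularQ : Prop :=
  type_of% @Summit.Langlands.Langlands.Cruxes.LanglandsOverQ.Birth.stub_autToGalIrregularQ

/-- The statement of `stub_weakGalToAutQ`, as a named `Prop` (literally its type). [folklore] -/
def stub_weakGalToAutQ : Prop :=
  type_of% @Summit.Langlands.Langlands.Cruxes.LanglandsOverQ.Birth.stub_weakGalToAutQ

end _Goal

/-! ## 3. The seam, theorems of the tree: uniqueness in (A) and weak ⇒ strong (B) -/

/-- **(A) from (A)-existence, for the same data**: if every L-algebraic cuspidal `π` has SOME irreducible
geometric `ρ` corresponding to it, then (A) holds — any two correspondents of `π`, one of them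
irreducible, are conjugate (Chebotarev + Brauer–Nesbitt, landed as
`Theorems.ReciprocityUpToIrreducibility.isConjugate_of_satakeFrobCompatibleAt`). [cite: DeligneSerreASENS1974, Lemme 3.2] -/
theorem automorphicToGalois_of_exists (R : ReciprocityData ℚ) {n : ℕ}
    (hcpt : Literature.NumberTheory.Automorphic.isCompact_glFiniteIntegralLevel n ℚ)
    (hE : ∀ (π : Literature.NumberTheory.Automorphic.CuspidalAutomorphicRepData n ℚ hcpt),
      π.1.IsLAlgebraic → ∀ (ℓ : ℕ) [Fact ℓ.Prime] (ι : PadicAlgCl ℓ ≃+* ℂ),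
        ∃ ρ : Literature.NumberTheory.GaloisRepresentations.FramedGaloisRep ℚ (PadicAlgCl ℓ) n,
          ρ.toGaloisRep.IsIrreducible ∧ IsGeometricFramed R ρ ∧ Corresponds R ι π.1 ρ) :
    AutomorphicToGalois n R hcpt := by
  intro π hL ℓ _ ι
  obtain ⟨ρ, hirr, hgeo, hcorr⟩ := hE π hL ℓ ι
  exact ⟨ρ, hirr, hgeo, hcorr, fun ρ' h' =>
    Theorems.ReciprocityUpToIrreducibility.isConjugate_of_satakeFrobCompatibleAt π.1 ι hirr hcorr.1 h'.1⟩

/-- **Weak-to-strong upgrade of direction (B), for the same reciprocity data** (the `ℚ`-instance of the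
exemplar's `galoisToAutomorphic_of_weak`, PROVED): if (A) holds for `R` in every rank and every irreducible
geometric `ρ` is Satake–Frobenius compatible a.e. with some L-algebraic cuspidal `π`, then (B) holds for
`R`: (A) gives some `ρ'` corresponding to that `π` at every prime, `ρ'` and `ρ` are two avatars of `π`
with `ρ` irreducible, hence conjugate, and `Corresponds` descends to conjugacy classes
(`corresponds_of_exists_corresponds`, landed, sorry-free).
[cite: DeligneSerreASENS1974, Lemme 3.2] [cite: BuzzardGeeLMS2014, Conj. 3.2.2] -/
theorem galoisToAutomorphic_of_weak (R : ReciprocityData ℚ)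
    (hA : ∀ n : ℕ, 0 < n →
      ∀ hcpt : Literature.NumberTheory.Automorphic.isCompact_glFiniteIntegralLevel n ℚ,
        AutomorphicToGalois n R hcpt)
    (hW : ∀ (n : ℕ), 0 < n → ∀ (ℓ : ℕ) [Fact ℓ.Prime] (ι : PadicAlgCl ℓ ≃+* ℂ)
      (ρ : Literature.NumberTheory.GaloisRepresentations.FramedGaloisRep ℚ (PadicAlgCl ℓ) n),
      ρ.toGaloisRep.IsIrreducible → IsGeometricFramed R ρ →
        ∀ hcpt : Literature.NumberTheory.Automorphic.isCompact_glFiniteIntegralLevel n ℚ,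
          ∃ π : Literature.NumberTheory.Automorphic.CuspidalAutomorphicRepData n ℚ hcpt,
            π.1.IsLAlgebraic ∧
              ∀ᶠ v : IsDedekindDomain.HeightOneSpectrum (NumberField.RingOfIntegers ℚ) in cofinite,
                SatakeFrobCompatibleAt ι π.1 ρ v) :
    ∀ n : ℕ, 0 < n →
      ∀ hcpt : Literature.NumberTheory.Automorphic.isCompact_glFiniteIntegralLevel n ℚ,
        GaloisToAutomorphic n R hcpt := by
  intro n hn hcpt ℓ _ ι ρ hirr hgeo
  obtain ⟨π, hL, hsat⟩ := hW n hn ℓ ι ρ hirr hgeo hcpt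
  obtain ⟨ρ', -, -, hcorr', -⟩ := hA n hn hcpt π hL ℓ ι
  exact ⟨π, hL,
    Theorems.ReciprocityUpToIrreducibility.corresponds_of_exists_corresponds hirr hsat ⟨ρ', hcorr'⟩⟩

/-! ## 4. The composition (kernel-checked, no `sorry`):
(A)_reg → ((A)_reg ⇒ (A)_irreg) → ((A) ⇒ weak (B)) → crux by name -/

/-- **`LanglandsOverQ` from the three stubs.**  Take `R` and the regular case of (A)-existence from
stub 1; the irregular case for that `R` from stub 2; (A)-existence for every L-algebraic cuspidal `π` by a
case split on the regularity of its infinity type; (A) with its uniqueness clause by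
`automorphicToGalois_of_exists`; weak (B) for `R` from stub 3 fed with (A); (B) with local–global
compatibility at every prime by `galoisToAutomorphic_of_weak`; so `GlobalLanglandsCorrespondenceGLn n ℚ R
hcpt = (A) ∧ (B)` for every `n ≥ 1`.  Hypotheses are, by name, the statements of `stub_autToGalRegularQ`,
`stub_autToGalIrregularQ`, `stub_weakGalToAutQ`; the conclusion is the route decl. [folklore] -/
theorem LanglandsOverQ_of (h₁ : _Goal.stub_autToGalRegularQ) (h₂ : _Goal.stub_autToGalIrregularQ)
    (h₃ : _Goal.stub_weakGalToAutQ) : LanglandsOverQ := by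
  unfold _Goal.stub_autToGalRegularQ at h₁
  unfold _Goal.stub_autToGalIrregularQ at h₂
  unfold _Goal.stub_weakGalToAutQ at h₃
  obtain ⟨R, hreg⟩ := h₁
  -- (A)-existence for every L-algebraic cuspidal π: case split on the weight seam
  have hE : ∀ n : ℕ, 0 < n →
      ∀ (hcpt : Literature.NumberTheory.Automorphic.isCompact_glFiniteIntegralLevel n ℚ)
        (π : Literature.NumberTheory.Automorphic.CuspidalAutomorphicRepData n ℚ hcpt),
        π.1.IsLAlgebraic → ∀ (ℓ : ℕ) [Fact ℓ.Prime] (ι : PadicAlgCl ℓ ≃+* ℂ),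
          ∃ ρ : Literature.NumberTheory.GaloisRepresentations.FramedGaloisRep ℚ (PadicAlgCl ℓ) n,
            ρ.toGaloisRep.IsIrreducible ∧ IsGeometricFramed R ρ ∧ Corresponds R ι π.1 ρ := by
    intro n hn hcpt π hL ℓ _ ι
    by_cases hr : ∃ T : Literature.NumberTheory.Automorphic.InfinityType ℚ n,
        π.1.HasInfinityType T ∧ T.IsLAlgebraic ∧ T.IsRegular
    · exact hreg n hn hcpt π hr ℓ ι
    · exact h₂ R hreg n hn hcpt π hL hr ℓ ι
  -- (A) with uniqueness up to conjugacy (Chebotarev–Brauer–Nesbitt, landed)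
  have hA : ∀ n : ℕ, 0 < n →
      ∀ hcpt : Literature.NumberTheory.Automorphic.isCompact_glFiniteIntegralLevel n ℚ,
        AutomorphicToGalois n R hcpt :=
    fun n hn hcpt => automorphicToGalois_of_exists R hcpt (hE n hn hcpt)
  -- (B) from weak (B) (stub 3 fed with (A)) by the weak-to-strong transport (landed)
  have hB : ∀ n : ℕ, 0 < n →
      ∀ hcpt : Literature.NumberTheory.Automorphic.isCompact_glFiniteIntegralLevel n ℚ,
        GaloisToAutomorphic n R hcpt :=
    galoisToAutomorphic_of_weak R hA (h₃ R hA)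
  exact ⟨R, fun n hn hcpt => ⟨hA n hn hcpt, hB n hn hcpt⟩⟩

/-- The shared sibling decl (same ledger item stmt-Langlands-16011, route TwistAveragedDeinduction) has
verbatim the same body, so the composition concludes it too. [folklore] -/
theorem langlandsOverQ_twistAveraged_of (h₁ : _Goal.stub_autToGalRegularQ)
    (h₂ : _Goal.stub_autToGalIrregularQ) (h₃ : _Goal.stub_weakGalToAutQ) :
    Summit.Langlands.Langlands.Theses.TwistAveragedDeinduction.LanglandsOverQ :=
  LanglandsOverQ_of h₁ h₂ h₃

/-- By-name sanity check (an `example`, not a declaration of the file): the three stubs feed the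
composition as they stand. -/
example : LanglandsOverQ := LanglandsOverQ_of stub_autToGalRegularQ stub_autToGalIrregularQ stub_weakGalToAutQ

end Summit.Langlands.Langlands.Cruxes.LanglandsOverQ.Birth

end
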